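import Literature.IUT.HodgeArakelov.BadPlaceSettingOfDoubleUnderline
import Literature.AnabelianGeometry.EtaleTheta.DoubleUnderlineTower
import HarnessLib

/-!
# [IUTchII] Prop. 2.1 at the [EtTh] MODEL with `Π^tp_{X_v} := Π^tp_{X̲_v}` (type `(1, l-tors)`): the repaired
# bad-place setting `BadPlaceSetting.ofUnderline`

S. Mochizuki, *Inter-universal Teichmüller theory II*, kurims manuscript (Dec. 2020) §2, p. 64 (the fixed data at
`v ∈ 𝕍^bad`), Prop. 2.1 pp. 64–65, Rmk. 2.1.1 (i) p. 65, Def. 2.3 (i) p. 67 (claim key `Mochizuki2012`, DISPUTED, D-0012);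
*IUT I* Def. 3.1 (d)(e) pp. 62–63; [EtTh] Def. 2.1 p. 36, Def. 2.5 (i) p. 39, Rmk. 2.3.1 p. 38
[cite: MochizukiEtTh2009, Def 2.5 (i) p.39].  abc-iut cell, seat abc-iut-L6-t19 gen 5; SIBLING of abc-iut-w4-d034's
`BadPlaceSettingOfDoubleUnderline.lean` (p413302) implementing the repair named in finding F-L6t19g5-1
(`BadPlaceSettingOfDoubleUnderlineLevels.lean`): nothing landed is edited; w4-d034's model and theorems stand.

THE POINT.  In [IUTchII] §2, "`X_v`" is `X̲_v := X̲_K ×_K K_v` of type `(1, l-tors)` ([IUTchI] Def. 3.1 (d)(e); [EtTh]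
Def. 2.1) — at `v ∈ 𝕍^bad` the level-`l` subcovering of `Y_v → X_v` (Rmk. 2.1.1 (i) "`Gal(Y_v/X_v)` … the subgroup
`l·ℤ ⊆ ℤ`"; Def. 2.3 (i) "`Π^±_v := Π^tp_{X_v}`", "`Π^±_v/Π_v ⥲ Gal(X̲̲_v/X_v) (≅ ℤ/lℤ)`").  abc-iut-L2-t7 carries exactly
this group in the [EtTh] §1 model: `ThetaSetting.GtpXu D l := toZ⁻¹(l·ℤ) = Π^tp_X̲` (`SingleUnderline.lean`), with
`Π^tp_X̲̲ ⊆ Π^tp_X̲` of index `l` (`DoubleUnderlineTower.lean`).  So: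

* `BadPlaceSetting.ofUnderline` — the [IUTchII] §2 setting of the Tate curve with `Π^tp_{X_v} := Π^tp_X̲ = D.GtpXu l`,
  the open injection `Π_v = Π^tp_X̲̲ ↪ Π^tp_X̲` (`Subgroup.inclusion`, abc-iut-L2-t7's `Huu_le_GtpXu`), `Π^tp_{Y_v} := Π^tp_Y`,
  `Π^tp_{Ÿ_v} := Π^tp_Ÿ` (as subgroups of `Π^tp_X̲`: `Y → X̲` is the `l·ℤ`-subcovering, `GtpY_le_GtpXu`); the underlying
  [IUTchII] §1 setting is w4-d034's/abc-iut-L6-d6's `ThetaSetting.ofDoubleUnderline` UNCHANGED (`ofUnderline_toThetaSetting`).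
  A CONSTRUCTION over landed data (no new `Prop` fact);
* **`ofUnderline_index_eq`** — `[Π^tp_{X_v} : Π_v] = l` at this model (abc-iut-L2-t7's `relIndex_Huu_GtpXu` BY NAME): the
  index print's Def. 2.3 (i) / abc-iut-L6-t1's `Def23_i_indices` (conjunct 3) demand of `Π^±_v ⊇ Π_v` — contrast
  `BadPlaceSetting.ofDoubleUnderline_index_eq_sq` (`l²` for the `(1,1)` curve);
* `ofUnderline_refY_comap`, `ofUnderline_refYdd_comap` — the top row `Π_v ∩ Π^tp_{Y_v}`, `Π_v ∩ Π^tp_{Ÿ_v}` is the SAME pair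
  of subgroups of `Π_v` as in w4-d034's model (abc-iut-L2-t8's `Π^tp_Y̲̲`, `Π^tp_Ÿ̲̲`), so
* `isTopCharacteristic_refY_refYdd_ofUnderline`, `TemperedCoverings.YL_eq_of_piYddCharacteristic'` — w4-d034's Prop. 2.1
  well-definedness modulo (H1) `EtaleThetaDataOfSetting.PiYddCharacteristic C` transfers verbatim.

[claim: Mochizuki2012, status: disputed]  Nothing here takes a side on [IUTchIII] Cor. 3.12; typed ≠ proved.  Deliberately NOT
here: a `PlusMinusTower` / `CuspidalInertiaData` at the model (needs `Π^tp_{C_v}` and its completion — abc-iut-L2's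
`ThetaCovers.CoverData` side — and the cuspidal inertia groups; MERGE-MAP rows 119/120).
-/

noncomputable section

namespace Literature.IUT.HodgeArakelov

open Literature.AnabelianGeometry.EtaleTheta

namespace BadPlaceSetting

variable {p : ℕ} [Fact p.Prime] {D : Literature.AnabelianGeometry.EtaleTheta.ThetaSetting p}
  {E : D.EtaleThetaData} {l : ℕ} (C : E.DoubleUnderline l) {N : ℕ+} (μ : D.CyclotomeMod l N)
  (hC : D.Compat) (hS : D.Sec2Hyps)

/-- **[IUTchII] §2 p. 64 / Prop. 2.1 AT THE [EtTh] MODEL, with `Π^tp_{X_v} := Π^tp_{X̲_v}`**: the [IUTchII] §1 setting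
`ThetaSetting.ofDoubleUnderline` of the Tate curve (bridge B8; `Π_v := Π^tp_X̲̲ = C.Huu`) extended by the bottom row of
Prop. 2.1 read at the printed level — `Π^tp_{X_v} := Π^tp_X̲ = toZ⁻¹(l·ℤ)` (abc-iut-L2-t7's `ThetaSetting.GtpXu`, the curve
`X̲_v` of type `(1, l-tors)` = `(1, ℤ/lℤ)`), the open injection `Π^tp_X̲̲ ↪ Π^tp_X̲`, `Π^tp_{Y_v} := Π^tp_Y = Ker(toZ)`,
`Π^tp_{Ÿ_v} := Π^tp_Ÿ` (open since `K = K̈`), both inside `Π^tp_X̲`.  A CONSTRUCTION over landed data.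
([IUTchII] Prop 2.1, kurims p.64) [claim: Mochizuki2012, status: disputed] -/
def ofUnderline (hl : l.Prime) (hp2 : p ≠ 2) (hpl : p ≠ l)
    (hζ : ∃ ζ : D.K, IsPrimitiveRoot ζ (4 * l)) {η : (C.thetaEnvData μ hC hS).PiYdd → MuN p N}
    (hη : η ∈ (C.thetaEnvData μ hC hS).thetaCocycles) : BadPlaceSetting.{0} where
  toThetaSetting := ThetaSetting.ofDoubleUnderline C μ hC hS hl hp2 hpl hζ hη
  PiXplain := TopGroup.of (D.GtpXu l)
  inclPlain := Subgroup.inclusion C.Huu_le_GtpXu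
  inclPlain_isOpenEmbedding :=
    (Topology.IsOpenEmbedding.of_comp_iff (Subgroup.inclusion C.Huu_le_GtpXu)
        ((D.isOpen_GtpXu l).isOpenEmbedding_subtypeVal)).mp
      C.isOpen_Huu.isOpenEmbedding_subtypeVal
  refY := D.GtpY.subgroupOf (D.GtpXu l)
  refYdd := D.GtpYdd.subgroupOf (D.GtpXu l)
  refYdd_le := fun _ hx => D.GtpYdd_le_GtpY hx
  isOpen_refY := D.isOpen_ker_toZ.preimage continuous_subtype_val
  isOpen_refYdd :=
    (Literature.AnabelianGeometry.EtaleTheta.ThetaSetting.EtaleThetaData.DoubleUnderline.isOpen_GtpYdd hS).preimage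
      continuous_subtype_val

variable (hl : l.Prime) (hp2 : p ≠ 2) (hpl : p ≠ l) (hζ : ∃ ζ : D.K, IsPrimitiveRoot ζ (4 * l))
  {η : (C.thetaEnvData μ hC hS).PiYdd → MuN p N} (hη : η ∈ (C.thetaEnvData μ hC hS).thetaCocycles)

/-- The underlying [IUTchII] §1 setting of `ofUnderline` is w4-d034's/abc-iut-L6-d6's `ThetaSetting.ofDoubleUnderline`
(same `Π_v`, `G_v`, model environment) — only the Prop. 2.1 ambient group differs from `BadPlaceSetting.ofDoubleUnderline`.
([IUTchII] Prop 2.1, kurims p.64) [claim: Mochizuki2012, status: disputed] -/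
theorem ofUnderline_toThetaSetting :
    (ofUnderline C μ hC hS hl hp2 hpl hζ hη).toThetaSetting =
      (ofDoubleUnderline C μ hC hS hl hp2 hpl hζ hη).toThetaSetting :=
  rfl

/-- Bookkeeping: `Π_v` of the model is `Π^tp_X̲̲ = C.Huu`, its `Π^tp_{X_v}` is `Π^tp_X̲ = D.GtpXu l`.
([IUTchII] Prop 2.1, kurims p.64) [claim: Mochizuki2012, status: disputed] -/
theorem ofUnderline_PiX :
    ((ofUnderline C μ hC hS hl hp2 hpl hζ hη).PiX : Type) = C.Huu ∧
      ((ofUnderline C μ hC hS hl hp2 hpl hζ hη).PiXplain : Type) = D.GtpXu l :=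
  ⟨rfl, rfl⟩

/-- The image of `Π_v ↪ Π^tp_{X_v}` is `Π^tp_X̲̲` viewed inside `Π^tp_X̲`. ([IUTchII] Prop 2.1, kurims p.64) [claim: Mochizuki2012, status: disputed] -/
theorem ofUnderline_range_inclPlain :
    (ofUnderline C μ hC hS hl hp2 hpl hζ hη).inclPlain.range = C.Huu.subgroupOf (D.GtpXu l) :=
  Subgroup.inclusion_range C.Huu_le_GtpXu

/-- **`[Π^tp_{X_v} : Π_v] = l` at this model** — the index print's Def. 2.3 (i) ("`Π^±_v/Π_v ⥲ Gal(X̲̲_v/X_v) (≅ ℤ/lℤ)`")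
and abc-iut-L6-t1's `Def23_i_indices` (conjunct 3) demand; abc-iut-L2-t7's `DoubleUnderline.relIndex_Huu_GtpXu` ("`X̲̲ → X̲`
extracts the second copy of `ℤ/lℤ`", [EtTh] Rmk. 2.3.1) BY NAME.  Contrast `BadPlaceSetting.ofDoubleUnderline_index_eq_sq`
(`l²` when `Π^tp_{X_v}` is taken to be the `(1,1)` curve's group).  PROVED. ([IUTchII] Def 2.3 (i), kurims p.67) [claim: Mochizuki2012, status: disputed] -/
theorem ofUnderline_index_eq :
    ((ofUnderline C μ hC hS hl hp2 hpl hζ hη).inclPlain.range).index = l := by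
  rw [ofUnderline_range_inclPlain]
  exact C.relIndex_Huu_GtpXu

/-- The reference subgroup `Π_v ∩ Π^tp_{Ÿ_v}` of this model IS `Π^tp_Ÿ̲̲ = Π^tp_Ÿ ∩ Π^tp_X̲̲ ⊆ Π^tp_X̲̲` — the same subgroup of
`Π_v` as in w4-d034's model (abc-iut-L2-t8's `(C.thetaEnvData …).PiYdd`, abc-iut-L6-t1's `EtaleThetaDataOfSetting.PiYdd C`).
([IUTchII] Prop 2.1, kurims p.65) [claim: Mochizuki2012, status: disputed] -/
theorem ofUnderline_refYdd_comap :
    (ofUnderline C μ hC hS hl hp2 hpl hζ hη).refYdd.comap (ofUnderline C μ hC hS hl hp2 hpl hζ hη).inclPlain =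
        D.GtpYdd.subgroupOf C.Huu ∧
      (ofUnderline C μ hC hS hl hp2 hpl hζ hη).refYdd.comap (ofUnderline C μ hC hS hl hp2 hpl hζ hη).inclPlain =
        (ofDoubleUnderline C μ hC hS hl hp2 hpl hζ hη).refYdd.comap
          (ofDoubleUnderline C μ hC hS hl hp2 hpl hζ hη).inclPlain :=
  ⟨rfl, rfl⟩

/-- The reference subgroup `Π_v ∩ Π^tp_{Y_v}` of this model IS `Π^tp_Y̲̲ = Π^tp_Y ∩ Π^tp_X̲̲` — the same subgroup of `Π_v` as in
w4-d034's model (abc-iut-L2-t8's `(C.thetaEnvData …).PiY`). ([IUTchII] Prop 2.1, kurims p.65) [claim: Mochizuki2012, status: disputed] -/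
theorem ofUnderline_refY_comap :
    (ofUnderline C μ hC hS hl hp2 hpl hζ hη).refY.comap (ofUnderline C μ hC hS hl hp2 hpl hζ hη).inclPlain =
        (C.thetaEnvData μ hC hS).PiY ∧
      (ofUnderline C μ hC hS hl hp2 hpl hζ hη).refY.comap (ofUnderline C μ hC hS hl hp2 hpl hζ hη).inclPlain =
        (ofDoubleUnderline C μ hC hS hl hp2 hpl hζ hη).refY.comap
          (ofDoubleUnderline C μ hC hS hl hp2 hpl hζ hη).inclPlain :=
  ⟨rfl, rfl⟩

/-- AT THIS MODEL TOO, abc-iut-L6-t1's named tempered-anabelian input (H1) `PiYddCharacteristic C` gives BOTH hypotheses of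
`TemperedCoverings.YL_eq_of_characteristic` (the pair of subgroups of `Π_v` is the same as in w4-d034's model, so his
`isTopCharacteristic_refY_refYdd_ofDoubleUnderline` transfers verbatim).  PROVED (modulo (H1)).
([IUTchII] Prop 2.1, kurims p.65) [claim: Mochizuki2012, status: disputed] -/
theorem isTopCharacteristic_refY_refYdd_ofUnderline (hH1 : EtaleThetaDataOfSetting.PiYddCharacteristic C) :
    IsTopCharacteristic (ofUnderline C μ hC hS hl hp2 hpl hζ hη).PiX
        ((ofUnderline C μ hC hS hl hp2 hpl hζ hη).refY.comap (ofUnderline C μ hC hS hl hp2 hpl hζ hη).inclPlain) ∧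
      IsTopCharacteristic (ofUnderline C μ hC hS hl hp2 hpl hζ hη).PiX
        ((ofUnderline C μ hC hS hl hp2 hpl hζ hη).refYdd.comap (ofUnderline C μ hC hS hl hp2 hpl hζ hη).inclPlain) :=
  isTopCharacteristic_refY_refYdd_ofDoubleUnderline C μ hC hS hl hp2 hpl hζ hη hH1

/-- **[IUTchII] Prop. 2.1, well-definedness AT THE REPAIRED MODEL modulo (H1)** (composition with abc-iut-w4-d010's
`TemperedCoverings.YL_eq_of_characteristic`): any two Prop. 2.1 outputs over the same topological group `P` for
`ofUnderline` have the same top row `Π^tp_{Ÿ̲_v} ⊆ Π^tp_{Y̲_v} ⊆ P`.  PROVED (modulo (H1)).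
([IUTchII] Prop 2.1, kurims p.65) [claim: Mochizuki2012, status: disputed] -/
theorem _root_.Literature.IUT.HodgeArakelov.TemperedCoverings.YL_eq_of_piYddCharacteristic'
    (hH1 : EtaleThetaDataOfSetting.PiYddCharacteristic C) {P : TopGroup.{0}}
    (T₁ T₂ : TemperedCoverings (ofUnderline C μ hC hS hl hp2 hpl hζ hη) P) :
    T₁.YL = T₂.YL ∧ T₁.YddL = T₂.YddL :=
  have h := isTopCharacteristic_refY_refYdd_ofUnderline C μ hC hS hl hp2 hpl hζ hη hH1
  TemperedCoverings.YL_eq_of_characteristic h.1 h.2 T₁ T₂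

end BadPlaceSetting

end Literature.IUT.HodgeArakelov

end
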